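import Mathlib

/-!
# Kernel-one far channels, I: Fubini and Green identities on half-characteristic trapezoids

Helper file for `stub_kernelOneChannels` of line `crum-peeling-recessive-tower` (crux
`UniformPhotonSphereChannelsR`, stmt-FinalStateConjecture-14074).  The energy (multiplier `∂_t`) and
momentum (multiplier `∂_x`) identities for `ψ_tt − ψ_xx + V(x)ψ = 0` that drive the wedge
inequality of the kernel-one far channel estimate live on two plane regions with ONE vertical side:

* the *vertical-left* trapezoid `{s ≤ τ ≤ t, A ≤ x ≤ b − τ}` (left side `x = A`, right side the
  incoming characteristic `x = b − τ`), and
* the *vertical-right* trapezoid `{s ≤ τ ≤ t, a + τ ≤ x ≤ B}` (left side the outgoing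
  characteristic `x = a + τ`, right side `x = B`).

This file proves, for continuous integrands, Fubini on the first region (`vtrap_integral_swap`,
adapted from `Literature.Analysis.PDE.trapezoid_integral_swap`) and the resulting Green identities
`∬ (∂_τ f + ∂_x g) = ∮ …` on both regions (`vtrap_green`, and `ctrap_green` by the reflection
`x ↦ −x`).  Pure calculus; no wave equation here.
-/

noncomputable section

-- the doubled `FinalStateConjecture.FinalStateConjecture` path component trips dupNamespace
set_option linter.dupNamespace false

namespace Summit.FinalStateConjecture.FinalStateConjecture.Theorems.CrumPeelingRecessiveTower

open MeasureTheory Set Filter Topology intervalIntegral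

/-- **Fubini on a vertical-left trapezoid.** For a continuous `G` on the plane, `s ≤ t` and
`A ≤ b − t`, integrating over `{s ≤ τ ≤ t, A ≤ x ≤ b − τ}` first in `x` or first in `τ` gives the
same result: `∫_s^t ∫_A^{b−τ} G(τ,x) dx dτ = ∫_A^{b−s} ∫_s^{min(t, b−x)} G(τ,x) dτ dx`. -/
theorem vtrap_integral_swap {G : ℝ × ℝ → ℝ} (hG : Continuous G) {A b s t : ℝ} (hst : s ≤ t)
    (hAb : A ≤ b - t) :
    ∫ τ in s..t, (∫ x in A..(b - τ), G (τ, x))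
      = ∫ x in A..(b - s), (∫ τ in s..(min t (b - x)), G (τ, x)) := by
  have hAbs : A ≤ b - s := by linarith
  set R : Set (ℝ × ℝ) := {p | p.1 ∈ Icc s t ∧ p.2 ∈ Icc A (b - p.1)} with hR
  have hRc : IsCompact R := by
    have hclosed : IsClosed R := by
      simp only [hR, mem_Icc]
      refine IsClosed.inter (IsClosed.inter ?_ ?_) (IsClosed.inter ?_ ?_)
      · exact isClosed_le continuous_const continuous_fst
      · exact isClosed_le continuous_fst continuous_const
      · exact isClosed_le continuous_const continuous_snd
      · exact isClosed_le continuous_snd (continuous_const.sub continuous_fst)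
    have hK : IsCompact (Icc s t ×ˢ Icc A (b - s)) := isCompact_Icc.prod isCompact_Icc
    refine hK.of_isClosed_subset hclosed ?_
    rintro ⟨τ, x⟩ ⟨⟨h1, h2⟩, h3, h4⟩
    dsimp only at h3 h4
    exact ⟨⟨h1, h2⟩, h3, by linarith⟩
  have hRm : MeasurableSet R := hRc.isClosed.measurableSet
  set F : ℝ × ℝ → ℝ := R.indicator G with hF
  have hFi : Integrable F ((volume : Measure ℝ).prod volume) := by
    rw [hF, integrable_indicator_iff hRm, ← Measure.volume_eq_prod]
    exact hG.continuousOn.integrableOn_compact hRc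
  have hswap : ∫ τ, ∫ x, F (τ, x) = ∫ x, ∫ τ, F (τ, x) := by
    rw [← integral_prod F hFi, integral_prod_symm F hFi]
  -- the `τ`-sections
  have hsec1 : ∀ τ, (∫ x, F (τ, x)) = (Icc s t).indicator
      (fun τ => ∫ x in A..(b - τ), G (τ, x)) τ := by
    intro τ
    by_cases hτ : τ ∈ Icc s t
    · rw [indicator_of_mem hτ]
      have hle : A ≤ b - τ := by linarith [hτ.2]
      have : (fun x => F (τ, x)) = (Icc A (b - τ)).indicator (fun x => G (τ, x)) := by
        funext x
        by_cases hx : x ∈ Icc A (b - τ)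
        · rw [indicator_of_mem hx, hF, indicator_of_mem (show (τ, x) ∈ R from ⟨hτ, hx⟩)]
        · rw [indicator_of_notMem hx, hF, indicator_of_notMem]
          exact fun h => hx h.2
      rw [this, MeasureTheory.integral_indicator measurableSet_Icc, integral_Icc_eq_integral_Ioc,
        ← integral_of_le hle]
    · rw [indicator_of_notMem hτ]
      have : (fun x => F (τ, x)) = fun _ => 0 := by
        funext x
        rw [hF, indicator_of_notMem]
        exact fun h => hτ h.1
      rw [this, MeasureTheory.integral_zero]
  -- the `x`-sections
  have hsec2 : ∀ x, (∫ τ, F (τ, x)) = (Icc A (b - s)).indicator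
      (fun x => ∫ τ in Icc s (min t (b - x)), G (τ, x)) x := by
    intro x
    by_cases hx : x ∈ Icc A (b - s)
    · rw [indicator_of_mem hx]
      have : (fun τ => F (τ, x)) = (Icc s (min t (b - x))).indicator (fun τ => G (τ, x)) := by
        funext τ
        have hiff : (τ, x) ∈ R ↔ τ ∈ Icc s (min t (b - x)) := by
          simp only [hR, mem_setOf_eq, mem_Icc, le_min_iff]
          constructor
          · rintro ⟨⟨h1, h2⟩, -, h4⟩; exact ⟨h1, h2, by linarith⟩
          · rintro ⟨h1, h2, h3⟩; exact ⟨⟨h1, h2⟩, hx.1, by linarith⟩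
        by_cases hτ : τ ∈ Icc s (min t (b - x))
        · rw [indicator_of_mem hτ, hF, indicator_of_mem (hiff.2 hτ)]
        · rw [indicator_of_notMem hτ, hF, indicator_of_notMem (fun h => hτ (hiff.1 h))]
      rw [this, MeasureTheory.integral_indicator measurableSet_Icc]
    · rw [indicator_of_notMem hx]
      have : (fun τ => F (τ, x)) = fun _ => 0 := by
        funext τ
        rw [hF, indicator_of_notMem]
        rintro ⟨⟨h1, -⟩, h3, h4⟩
        exact hx ⟨h3, by linarith⟩
      rw [this, MeasureTheory.integral_zero]
  simp_rw [hsec1, hsec2, MeasureTheory.integral_indicator measurableSet_Icc] at hswap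
  have hL : (∫ τ in Icc s t, ∫ x in A..(b - τ), G (τ, x))
      = ∫ τ in s..t, ∫ x in A..(b - τ), G (τ, x) := by
    rw [integral_of_le hst, integral_Icc_eq_integral_Ioc]
  have hR' : (∫ x in Icc A (b - s), ∫ τ in Icc s (min t (b - x)), G (τ, x))
      = ∫ x in A..(b - s), ∫ τ in s..(min t (b - x)), G (τ, x) := by
    rw [integral_of_le hAbs,
      integral_Icc_eq_integral_Ioc (f := fun x => ∫ τ in Icc s (min t (b - x)), G (τ, x))]
    refine setIntegral_congr_fun measurableSet_Ioc fun x hx => ?_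
    rw [integral_of_le (le_min hst (by linarith [hx.2])), integral_Icc_eq_integral_Ioc]
  rw [← hL, hswap, hR']

/-- **Green's identity on a vertical-left trapezoid.** Let `f, g : ℝ → ℝ → ℝ` (time first) be
jointly continuous with jointly continuous partial derivatives `∂_τ f = fτ` and `∂_x g = gx`.
Then for `s ≤ t`, `A ≤ b − t`, on `{s ≤ τ ≤ t, A ≤ x ≤ b − τ}`:
`∫_s^t ∫_A^{b−τ} (fτ + gx) dx dτ = ∫_A^{b−t} f(t,·) + ∫_{b−t}^{b−s} f(b−x, x) dx − ∫_A^{b−s} f(s,·) + ∫_s^t g(τ, b−τ) dτ − ∫_s^t g(τ, A) dτ`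
(top, incoming characteristic side, base; characteristic side and vertical side). -/
theorem vtrap_green {f g fτ gx : ℝ → ℝ → ℝ} (hf : Continuous (Function.uncurry f))
    (hg : Continuous (Function.uncurry g)) (hfτ : Continuous (Function.uncurry fτ))
    (hgx : Continuous (Function.uncurry gx))
    (hdf : ∀ τ x, HasDerivAt (fun σ => f σ x) (fτ τ x) τ)
    (hdg : ∀ τ x, HasDerivAt (g τ) (gx τ x) x)
    {A b s t : ℝ} (hst : s ≤ t) (hAb : A ≤ b - t) :
    ∫ τ in s..t, ∫ x in A..(b - τ), (fτ τ x + gx τ x)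
      = (∫ x in A..(b - t), f t x) + (∫ x in (b - t)..(b - s), f (b - x) x)
        - (∫ x in A..(b - s), f s x)
        + ((∫ τ in s..t, g τ (b - τ)) - ∫ τ in s..t, g τ A) := by
  have hcont2 : ∀ {φ : ℝ → ℝ → ℝ}, Continuous (Function.uncurry φ) →
      ∀ {u v : ℝ → ℝ}, Continuous u → Continuous v → Continuous fun y => φ (u y) (v y) :=
    fun hφ u v hu hv => hφ.comp (hu.prodMk hv)
  -- split the integrand; the `gx` part integrates directly
  have hinner : ∀ τ, (∫ x in A..(b - τ), (fτ τ x + gx τ x))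
      = (∫ x in A..(b - τ), fτ τ x) + (g τ (b - τ) - g τ A) := by
    intro τ
    have c1 : Continuous fun x => fτ τ x := hcont2 hfτ continuous_const continuous_id
    have c2 : Continuous fun x => gx τ x := hcont2 hgx continuous_const continuous_id
    rw [intervalIntegral.integral_add (c1.intervalIntegrable _ _) (c2.intervalIntegrable _ _),
      integral_eq_sub_of_hasDerivAt (fun x _ => hdg τ x) (c2.intervalIntegrable _ _)]
  have hP : Continuous fun τ => ∫ x in A..(b - τ), fτ τ x :=
    (intervalIntegral.continuous_parametric_primitive_of_continuous (μ := volume) (a₀ := A)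
      hfτ).comp (continuous_id.prodMk (continuous_const.sub continuous_id))
  have hgr : Continuous fun τ => g τ (b - τ) :=
    hcont2 hg continuous_id (continuous_const.sub continuous_id)
  have hgl : Continuous fun τ => g τ A := hcont2 hg continuous_id continuous_const
  have hgrl : Continuous fun τ => g τ (b - τ) - g τ A := hgr.sub hgl
  rw [intervalIntegral.integral_congr fun τ _ => hinner τ,
    intervalIntegral.integral_add (hP.intervalIntegrable _ _) (hgrl.intervalIntegrable _ _),
    intervalIntegral.integral_sub (hgr.intervalIntegrable _ _) (hgl.intervalIntegrable _ _)]
  congr 1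
  -- Fubini on the `fτ` part, then the fundamental theorem of calculus in `τ`
  have hswap := vtrap_integral_swap (G := Function.uncurry fτ) hfτ hst hAb
  simp only [Function.uncurry_apply_pair] at hswap
  rw [hswap]
  have hinner2 : ∀ x m, (∫ τ in s..m, fτ τ x) = f m x - f s x := fun x m =>
    integral_eq_sub_of_hasDerivAt (fun τ _ => hdf τ x)
      ((hcont2 hfτ continuous_id continuous_const).intervalIntegrable _ _)
  simp_rw [hinner2]
  -- split `[A, b - s]` at `b - t`
  set m : ℝ → ℝ := fun x => min t (b - x) with hm_def
  have hm_cont : Continuous m := by simp only [hm_def]; fun_prop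
  have htop : Continuous fun x => f (m x) x := hcont2 hf hm_cont continuous_id
  have hbase : Continuous fun x => f s x := hcont2 hf continuous_const continuous_id
  have hii : ∀ u v, IntervalIntegrable (fun x => f (m x) x) volume u v :=
    fun u v => htop.intervalIntegrable u v
  rw [intervalIntegral.integral_sub (hii _ _) (hbase.intervalIntegrable _ _),
    ← integral_add_adjacent_intervals (hii A (b - t)) (hii (b - t) (b - s))]
  have e1 : (∫ x in A..(b - t), f (m x) x) = ∫ x in A..(b - t), f t x := by
    refine integral_congr fun x hx => ?_
    rw [uIcc_of_le hAb] at hx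
    have : m x = t := by simp only [hm_def]; exact min_eq_left (by linarith [hx.2])
    simp only [this]
  have e2 : (∫ x in (b - t)..(b - s), f (m x) x) = ∫ x in (b - t)..(b - s), f (b - x) x := by
    refine integral_congr fun x hx => ?_
    rw [uIcc_of_le (by linarith : b - t ≤ b - s)] at hx
    have : m x = b - x := by simp only [hm_def]; exact min_eq_right (by linarith [hx.1])
    simp only [this]
  rw [e1, e2]

/-- **Green's identity on a vertical-right trapezoid** (the reflection `x ↦ −x` of
`vtrap_green`). With `f, g, fτ, gx` as there, for `s ≤ t` and `a + t ≤ B`, on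
`{s ≤ τ ≤ t, a + τ ≤ x ≤ B}`:
`∫_s^t ∫_{a+τ}^{B} (fτ + gx) dx dτ = ∫_{a+t}^{B} f(t,·) + ∫_{a+s}^{a+t} f(x−a, x) dx − ∫_{a+s}^{B} f(s,·) + ∫_s^t g(τ, B) dτ − ∫_s^t g(τ, a+τ) dτ`. -/
theorem ctrap_green {f g fτ gx : ℝ → ℝ → ℝ} (hf : Continuous (Function.uncurry f))
    (hg : Continuous (Function.uncurry g)) (hfτ : Continuous (Function.uncurry fτ))
    (hgx : Continuous (Function.uncurry gx))
    (hdf : ∀ τ x, HasDerivAt (fun σ => f σ x) (fτ τ x) τ)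
    (hdg : ∀ τ x, HasDerivAt (g τ) (gx τ x) x)
    {a B s t : ℝ} (hst : s ≤ t) (haB : a + t ≤ B) :
    ∫ τ in s..t, ∫ x in (a + τ)..B, (fτ τ x + gx τ x)
      = (∫ x in (a + t)..B, f t x) + (∫ x in (a + s)..(a + t), f (x - a) x)
        - (∫ x in (a + s)..B, f s x)
        + ((∫ τ in s..t, g τ B) - ∫ τ in s..t, g τ (a + τ)) := by
  -- reflect in `x`
  have hrefl : ∀ {φ : ℝ → ℝ → ℝ}, Continuous (Function.uncurry φ) →
      Continuous (Function.uncurry fun τ y => φ τ (-y)) := fun hφ =>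
    hφ.comp (continuous_fst.prodMk continuous_snd.neg)
  have h := vtrap_green (f := fun τ y => f τ (-y)) (g := fun τ y => -g τ (-y))
    (fτ := fun τ y => fτ τ (-y)) (gx := fun τ y => gx τ (-y)) (hrefl hf) (hrefl hg).neg
    (hrefl hfτ) (hrefl hgx) (fun τ y => hdf τ (-y)) (fun τ y => by
      have h1 := ((hdg τ (-y)).comp y (hasDerivAt_neg y)).neg
      refine h1.congr_deriv ?_
      ring) (A := -B) (b := -a) hst (by linarith)
  -- translate every integral back
  have i1 : ∀ τ, (∫ y in (-B)..(-a - τ), (fτ τ (-y) + gx τ (-y)))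
      = ∫ x in (a + τ)..B, (fτ τ x + gx τ x) := by
    intro τ
    rw [intervalIntegral.integral_comp_neg (fun x => fτ τ x + gx τ x)]
    simp [neg_sub, sub_neg_eq_add, add_comm]
  have i2 : (∫ y in (-B)..(-a - t), f t (-y)) = ∫ x in (a + t)..B, f t x := by
    rw [intervalIntegral.integral_comp_neg (fun x => f t x)]
    simp [neg_sub, sub_neg_eq_add, add_comm]
  have i3 : (∫ y in (-a - t)..(-a - s), f (-a - y) (-y)) = ∫ x in (a + s)..(a + t), f (x - a) x := by
    have e : (fun y => f (-a - y) (-y)) = fun y => (fun x => f (x - a) x) (-y) := by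
      funext y; simp only; congr 1; ring
    rw [e, intervalIntegral.integral_comp_neg (fun x => f (x - a) x)]
    simp [neg_sub, sub_neg_eq_add, add_comm]
  have i4 : (∫ y in (-B)..(-a - s), f s (-y)) = ∫ x in (a + s)..B, f s x := by
    rw [intervalIntegral.integral_comp_neg (fun x => f s x)]
    simp [neg_sub, sub_neg_eq_add, add_comm]
  have i5 : (∫ τ in s..t, -g τ (-(-a - τ))) = -∫ τ in s..t, g τ (a + τ) := by
    rw [← intervalIntegral.integral_neg]
    refine integral_congr fun τ _ => ?_
    congr 2; ring
  have i6 : (∫ τ in s..t, -g τ (-(-B))) = -∫ τ in s..t, g τ B := by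
    rw [← intervalIntegral.integral_neg]
    simp
  rw [intervalIntegral.integral_congr fun τ _ => i1 τ, i2, i3, i4, i5, i6] at h
  rw [h]
  ring

/-- Registered form of `vtrap_green` (sub-goal `stub_kernelOneGreen` of the crux item). -/
theorem stub_kernelOneGreen : ∀ (f g fτ gx : ℝ → ℝ → ℝ), Continuous (Function.uncurry f) →
    Continuous (Function.uncurry g) → Continuous (Function.uncurry fτ) →
    Continuous (Function.uncurry gx) → (∀ τ x, HasDerivAt (fun σ => f σ x) (fτ τ x) τ) →
    (∀ τ x, HasDerivAt (g τ) (gx τ x) x) → ∀ (A b s t : ℝ), s ≤ t → A ≤ b - t →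
    (∫ τ in s..t, ∫ x in A..(b - τ), (fτ τ x + gx τ x)) = (∫ x in A..(b - t), f t x)
      + (∫ x in (b - t)..(b - s), f (b - x) x) - (∫ x in A..(b - s), f s x)
      + ((∫ τ in s..t, g τ (b - τ)) - ∫ τ in s..t, g τ A) :=
  fun _ _ _ _ hf hg hfτ hgx hdf hdg _ _ _ _ hst hAb => vtrap_green hf hg hfτ hgx hdf hdg hst hAb

end Summit.FinalStateConjecture.FinalStateConjecture.Theorems.CrumPeelingRecessiveTower
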